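import Summits.NavierStokesRegularity.FluidComputer.PalasekTowerFaceConstants
import Summits.NavierStokesRegularity.FluidComputer.PalasekTowerHeredityWitnessCalibration

/-!
# The τ₁ faces of the register as universal Navier–Stokes constants, IV: the face numbers, CERTIFIED
# (crux idea `universal-face-constants`, stmt-NavierStokesRegularity-19179)

Cell `ns-blowup`, seat `ns-palasek-19179-p2` (g2; holder of record of the crux `EpisodeBase` = `EpisodeBaseG` of the route
`PalasekTowerBreakdown`, item stmt-NavierStokesRegularity-19179, line `slot`). Sequel of `PalasekTowerFaceConstants.lean`.
Every memo of the cell quotes the level-`0` face numbers of the crux idea card `universal-face-constants` (lens `dual`,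
19179 evidence #53; refuter4 K90 (2) re-derived them by hand: «windowCeil 0 = 3826.49, gradFloorCeil 0 = 0.057754,
forceCeil 0 = 1.3609e-8, windowStart 0 = 905.02, runRatio 0 = 2.0562, floorOverStart 0 = 1.2337, windowAnch = 325.81,
runAnch = 3.4270, floorAnch = 2.0562»). This file CERTIFIES decimal brackets for them in the kernel, from ecbridge-6 g3's
dyadic brackets of the wide rates (`PalasekTowerHeredityWitnessCalibration`: `Y₀ ∈ (1351, 1352)`, `Y₁ ∈ (2778, 2779)`,
`A₀ ∈ (345901, 345902)`, `A₁`, `A₂`, `Y₂`, `log N₁ = (44/5) log 2`, Mathlib's `log 2` to nine digits) plus one finer bracket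
`Y₀ ∈ (1351.1, 1351.2)`. LABEL: E–C typing (KERNEL, certified arithmetic). WHAT THIS IS NOT: not Navier–Stokes evidence —
arithmetic of the REGISTER's constants; nothing about any flow.

## Contents (all for the wide rates `N₀ = 256`, `b = 11/10`, `β = 23/10`, `Rigid` constants `c₁ = 1`, `c₂ = 5/3`, `c₅ = 4bβ`)

* `wide_Y_zero_bounds_fine : 1351.1 < Y₀ < 1351.2`; `window_zero_eq : window 0 = (11132/125) log 2 / A₀`,
  `window_zero_bounds : 1.7845e-4 < window 0 < 1.7846e-4`;
* anchored units: `floorAnch ∈ (2.055, 2.057)` (`= Y₁/Y₀ = 256^{13/100}`), `runAnch ∈ (3.425, 3.429)`,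
  `windowAnch ∈ (325.7, 325.9)`, `forceAnch ∈ (5.47e-7, 5.48e-7)`;
* start units: `runRatio 0 = floorAnch`, `floorOverStart 0 ∈ (1.233, 1.235)`, `windowStart 0 ∈ (904.7, 905.3)`;
* ceiling units: `gradFloorCeil 0 ∈ (0.0577, 0.0578)`, `gradFloorCeil 1 ∈ (0.0480, 0.0482)`, `windowCeil 0 ∈ (3825, 3829)`,
  `forceCeil 0 ∈ (1.35e-8, 1.37e-8)`.

References: S. Palasek, arXiv:2605.13827 §3.3 [cite: Palasek2026ElementaryModel, §3.3].
-/

noncomputable section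

namespace Summit.NavierStokesRegularity.FluidComputer.PalasekTowerClayBridge

open Set MeasureTheory Filter Topology Function
open scoped ENNReal ContDiff NNReal
open Literature.Analysis.FluidPDE

namespace UniversalFace

open TowerRates

/-! ## §1 One finer bracket and the closed form of the first window -/

/-- `Y₀ = 2^{52/5} ∈ (1351.1, 1351.2)` (`1351.1⁵ < 2⁵² < 1351.2⁵`). [folklore] -/
theorem wide_Y_zero_bounds_fine : 1351.1 < wide.Y 0 ∧ wide.Y 0 < 1351.2 := by
  rw [wide_Y_eq_two_rpow]
  exact ⟨lt_two_rpow_of_pow_lt (a := 52) (m := 1) (r := 5) (by norm_num) (by norm_num),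
    two_rpow_lt_of_pow_lt (by norm_num) (a := 52) (m := 1) (r := 5) (by norm_num) (by norm_num)⟩

/-- The rigid constants of the wide rates: `b = 11/10`. [folklore] -/
theorem wide_b : wide.b = 11 / 10 := by norm_num [wide]

/-- The rigid constants of the wide rates: `β = 23/10`. [folklore] -/
theorem wide_β : wide.β = 23 / 10 := by norm_num [wide]

/-- **Closed form of the first window**: `w₀ = 4bβ log N₁ / A₀ = (11132/125) · log 2 / A₀`
(`4 · (11/10) · (23/10) · (44/5) = 11132/125 = 89.056`). [cite: Palasek2026ElementaryModel, §3.3] -/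
theorem window_zero_eq : window 0 = (11132 / 125) * Real.log 2 / wide.A 0 := by
  have h : window 0 = 4 * wide.b * wide.β * Real.log (wide.N 1) / wide.A 0 := rfl
  rw [h, wide_log_N_one, wide_b, wide_β]
  ring

/-- `w₀ ∈ (1.7845e-4, 1.7846e-4)` (= `Schedule.Rigid.window_zero_bounds` for the closed form). [folklore] -/
theorem window_zero_bounds : (17845 : ℝ) / 10 ^ 8 < window 0 ∧ window 0 < 17846 / 10 ^ 8 := by
  rw [window_zero_eq]
  obtain ⟨hA1, hA2⟩ := wide_A_zero_bounds
  have hl1 := Real.log_two_gt_d9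
  have hl2 := Real.log_two_lt_d9
  have hA : 0 < wide.A 0 := by linarith
  constructor
  · rw [lt_div_iff₀ hA]; nlinarith
  · rw [div_lt_iff₀ hA]; nlinarith

/-! ## §2 Anchored units (`m = c₁ Y₀ = Y₀`) -/

/-- **Speed face, anchored**: `floorAnch = Y₁ / Y₀ ∈ (2.055, 2.057)` (the card's `256^{0.13} = 2.056`). [folklore] -/
theorem floorAnch_bounds : 2.055 < floorAnch ∧ floorAnch < 2.057 := by
  obtain ⟨hY01, hY02⟩ := wide_Y_zero_bounds_fine
  obtain ⟨hY11, hY12⟩ := wide_Y_one_bounds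
  have hY0 : 0 < wide.Y 0 := by linarith
  have h : floorAnch = wide.Y 1 / wide.Y 0 := rfl
  rw [h]
  constructor
  · rw [lt_div_iff₀ hY0]; nlinarith
  · rw [div_lt_iff₀ hY0]; nlinarith

/-- **Running bound, anchored**: `runAnch = (5/3) Y₁ / Y₀ ∈ (3.425, 3.429)` (the card's `3.427`). [folklore] -/
theorem runAnch_bounds : 3.425 < runAnch ∧ runAnch < 3.429 := by
  obtain ⟨h1, h2⟩ := floorAnch_bounds
  have h : runAnch = (5 / 3) * floorAnch := by
    simp only [runAnch, floorAnch]
    ring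
  rw [h]
  constructor <;> linarith

/-- **Window, anchored**: `windowAnch = w₀ Y₀² ∈ (325.7, 325.9)` (the card's `325.8` viscous times). [folklore] -/
theorem windowAnch_bounds : 325.7 < windowAnch ∧ windowAnch < 325.9 := by
  obtain ⟨hw1, hw2⟩ := window_zero_bounds
  obtain ⟨hY1, hY2⟩ := wide_Y_zero_bounds_fine
  have h : windowAnch = window 0 * wide.Y 0 ^ 2 := rfl
  have hsq1 : (1351.1 : ℝ) ^ 2 < wide.Y 0 ^ 2 := by nlinarith
  have hsq2 : wide.Y 0 ^ 2 < (1351.2 : ℝ) ^ 2 := by nlinarith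
  have hw0 : 0 < window 0 := by linarith
  rw [h]
  constructor
  · have := mul_lt_mul'' hw1 hsq1 (by norm_num) (by norm_num)
    linarith
  · have := mul_lt_mul'' hw2 hsq2 hw0.le (by positivity)
    linarith

/-- **Force budget, anchored**: `forceAnch = Y₀ / Y₀³ = Y₀⁻² ∈ (5.47e-7, 5.48e-7)` (the card's «force authority
5.5e-7 — nil»). [folklore] -/
theorem forceAnch_bounds : (547 : ℝ) / 10 ^ 9 < forceAnch ∧ forceAnch < 548 / 10 ^ 9 := by
  obtain ⟨hY1, hY2⟩ := wide_Y_zero_bounds_fine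
  have hY0 : 0 < wide.Y 0 := by linarith
  have h : forceAnch = 1 / wide.Y 0 ^ 2 := by
    have h' : forceAnch = wide.Y 0 / wide.Y 0 ^ 3 := rfl
    rw [h']
    field_simp
  have hsq : 0 < wide.Y 0 ^ 2 := by positivity
  rw [h]
  constructor
  · rw [lt_div_iff₀ hsq]; nlinarith
  · rw [div_lt_iff₀ hsq]; nlinarith

/-! ## §3 Start units (`m = c₂ Y₀ = (5/3) Y₀`) -/

/-- The running bound over the start speed at level `0` is the anchored floor ratio `Y₁/Y₀`. [folklore] -/
theorem runRatio_zero_eq_floorAnch : runRatio 0 = floorAnch := rfl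

/-- `runRatio 0 ∈ (2.055, 2.057)`. [folklore] -/
theorem runRatio_zero_bounds : 2.055 < runRatio 0 ∧ runRatio 0 < 2.057 := floorAnch_bounds

/-- **Speed face in start units**: `floorOverStart 0 = (3/5) Y₁/Y₀ ∈ (1.233, 1.235)` (the card's `1.234`). [folklore] -/
theorem floorOverStart_zero_bounds : 1.233 < floorOverStart 0 ∧ floorOverStart 0 < 1.235 := by
  obtain ⟨h1, h2⟩ := floorAnch_bounds
  obtain ⟨hY1, _⟩ := wide_Y_zero_bounds_fine
  have hY0 : wide.Y 0 ≠ 0 := by positivity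
  have h : floorOverStart 0 = (3 / 5) * floorAnch := by
    have h' : floorOverStart 0 = wide.Y (0 + 1) / ((5 / 3) * wide.Y 0) := rfl
    rw [h']
    simp only [floorAnch, zero_add]
    field_simp
  rw [h]
  constructor <;> linarith

/-- **Window in start units**: `windowStart 0 = w₀ ((5/3) Y₀)² = (25/9) windowAnch ∈ (904.7, 905.3)` (the card's `905.0`).
[folklore] -/
theorem windowStart_zero_bounds : 904.7 < windowStart 0 ∧ windowStart 0 < 905.3 := by
  obtain ⟨h1, h2⟩ := windowAnch_bounds
  have h : windowStart 0 = (25 / 9) * windowAnch := by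
    have h' : windowStart 0 = window 0 * ((5 / 3) * wide.Y 0) ^ 2 := rfl
    rw [h']
    simp only [windowAnch]
    ring
  rw [h]
  constructor <;> linarith

/-! ## §4 Ceiling units (`M = c₂ Y_{k+1} = (5/3) Y_{k+1}`) -/

/-- **Strain face, window `0`**: `gradFloorCeil 0 = A₁ / ((5/3) Y₁)² ∈ (0.0577, 0.0578)` (K90: `0.057754`). [folklore] -/
theorem gradFloorCeil_zero_bounds : 0.0577 < gradFloorCeil 0 ∧ gradFloorCeil 0 < 0.0578 := by
  obtain ⟨hA1, hA2⟩ := wide_A_one_bounds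
  obtain ⟨hY1, hY2⟩ := wide_Y_one_bounds
  have h : gradFloorCeil 0 = wide.A (0 + 1) / ((5 / 3) * wide.Y (0 + 1)) ^ 2 := rfl
  rw [h, zero_add]
  have hden : 0 < ((5 / 3 : ℝ) * wide.Y 1) ^ 2 := by positivity
  have hsq1 : (2778 : ℝ) ^ 2 < wide.Y 1 ^ 2 := by nlinarith
  have hsq2 : wide.Y 1 ^ 2 < (2779 : ℝ) ^ 2 := by nlinarith
  constructor
  · rw [lt_div_iff₀ hden]; nlinarith
  · rw [div_lt_iff₀ hden]; nlinarith

/-- **Strain face, window `1`** (the window of item 19249): `gradFloorCeil 1 = A₂ / ((5/3) Y₂)² ∈ (0.0480, 0.0482)`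
(the card's `0.0481`). [folklore] -/
theorem gradFloorCeil_one_bounds : 0.0480 < gradFloorCeil 1 ∧ gradFloorCeil 1 < 0.0482 := by
  obtain ⟨hA1, hA2⟩ := wide_A_two_bounds
  obtain ⟨hY1, hY2⟩ := wide_Y_two_bounds
  have h : gradFloorCeil 1 = wide.A (1 + 1) / ((5 / 3) * wide.Y (1 + 1)) ^ 2 := rfl
  rw [h, show (1 : ℕ) + 1 = 2 from rfl]
  have hden : 0 < ((5 / 3 : ℝ) * wide.Y 2) ^ 2 := by positivity
  have hsq1 : (6139 : ℝ) ^ 2 < wide.Y 2 ^ 2 := by nlinarith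
  have hsq2 : wide.Y 2 ^ 2 < (6140 : ℝ) ^ 2 := by nlinarith
  constructor
  · rw [lt_div_iff₀ hden]; nlinarith
  · rw [div_lt_iff₀ hden]; nlinarith

/-- **Window in ceiling units**: `windowCeil 0 = w₀ ((5/3) Y₁)² ∈ (3825, 3829)` (K90: `3826.49`; the bracket is as wide as
`Y₁ ∈ (2778, 2779)` allows). [folklore] -/
theorem windowCeil_zero_bounds : 3825 < windowCeil 0 ∧ windowCeil 0 < 3829 := by
  obtain ⟨hw1, hw2⟩ := window_zero_bounds
  obtain ⟨hY1, hY2⟩ := wide_Y_one_bounds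
  have h : windowCeil 0 = window 0 * ((5 / 3) * wide.Y (0 + 1)) ^ 2 := rfl
  rw [h, zero_add]
  have hsq1 : ((5 / 3 : ℝ) * 2778) ^ 2 < ((5 / 3) * wide.Y 1) ^ 2 := by nlinarith
  have hsq2 : ((5 / 3) * wide.Y 1) ^ 2 < ((5 / 3 : ℝ) * 2779) ^ 2 := by nlinarith
  have hw0 : 0 < window 0 := by linarith
  constructor
  · have := mul_lt_mul'' hw1 hsq1 (by norm_num) (by positivity)
    linarith
  · have := mul_lt_mul'' hw2 hsq2 hw0.le (by positivity)
    linarith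

/-- **Force budget in ceiling units**: `forceCeil 0 = Y₀ / ((5/3) Y₁)³ ∈ (1.35e-8, 1.37e-8)` (K90: `1.3609e-8`). [folklore] -/
theorem forceCeil_zero_bounds : (135 : ℝ) / 10 ^ 10 < forceCeil 0 ∧ forceCeil 0 < 137 / 10 ^ 10 := by
  obtain ⟨hY01, hY02⟩ := wide_Y_zero_bounds_fine
  obtain ⟨hY11, hY12⟩ := wide_Y_one_bounds
  have h : forceCeil 0 = wide.Y 0 / ((5 / 3) * wide.Y (0 + 1)) ^ 3 := rfl
  rw [h, zero_add]
  have hden : 0 < ((5 / 3 : ℝ) * wide.Y 1) ^ 3 := by positivity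
  have hcu1 : ((5 / 3 : ℝ) * 2778) ^ 3 < ((5 / 3) * wide.Y 1) ^ 3 := by
    gcongr
  have hcu2 : ((5 / 3) * wide.Y 1) ^ 3 < ((5 / 3 : ℝ) * 2779) ^ 3 := by
    gcongr
  constructor
  · rw [lt_div_iff₀ hden]; nlinarith
  · rw [div_lt_iff₀ hden]; nlinarith

end UniversalFace

end Summit.NavierStokesRegularity.FluidComputer.PalasekTowerClayBridge

end
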